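import Summits.KontsevichZagierPeriods.Zeta5Search.LaiSweepShard

/-!
# `κ₃` sweep certificate — shard file 017 of 127 (shards 119–125 of 889)

HONEST FRAMING. Systematic search; no irrationality claim unless certified. This file only checks,
by `decide +kernel`, shards 119–125 of the order-cell sweep of the `κ₃` point `(74, 2180, 444; δ74)`
(engine `LaiSweepEngine`, soundness `LaiSweepJump/Free/Eval/Shard/Kappa3`; a shard is `⟨regime, n,
p, q, p', q', Lo, Up⟩`: `n` cells from `p/q` to `p'/q'` with integer rate sums in `[Lo, Up]`, `K =
128`, `D = 2^40`). It draws NO conclusion: only the capstone `LaiKappa3SweepCert`, which needs all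
127 shard files, does. Kernel cost of this file ≈ 560 cells × 0.3 s.
-/

namespace Summit.KontsevichZagierPeriods.Zeta5Search.Sweep

set_option maxHeartbeats 100000000 in
/-- Shard 119: 80 cells of regime B from `10/317` to `13/397`.
[cite: Lai2024BallRivoal, §4 Lemma 4.3] -/
theorem shard119 :
    Shard.check 128 (2^40)
      ⟨true, 80, 10, 317, 13, 397, 217098895881905, 217358383677339⟩ = true := by
  decide +kernel

set_option maxHeartbeats 100000000 in
/-- Shard 120: 80 cells of regime B from `13/397` to `11/323`.
[cite: Lai2024BallRivoal, §4 Lemma 4.3] -/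
theorem shard120 :
    Shard.check 128 (2^40)
      ⟨true, 80, 13, 397, 11, 323, 228194872095324, 228473330941874⟩ = true := by
  decide +kernel

set_option maxHeartbeats 100000000 in
/-- Shard 121: 80 cells of regime B from `11/323` to `3/85`.
[cite: Lai2024BallRivoal, §4 Lemma 4.3] -/
theorem shard121 :
    Shard.check 128 (2^40)
      ⟨true, 80, 11, 323, 3, 85, 206861032576800, 207120201716745⟩ = true := by
  decide +kernel

set_option maxHeartbeats 100000000 in
/-- Shard 122: 80 cells of regime B from `3/85` to `16/437`.
[cite: Lai2024BallRivoal, §4 Lemma 4.3] -/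
theorem shard122 :
    Shard.check 128 (2^40)
      ⟨true, 80, 3, 85, 16, 437, 210111882572497, 210396486756383⟩ = true := by
  decide +kernel

set_option maxHeartbeats 100000000 in
/-- Shard 123: 80 cells of regime B from `16/437` to `5/132`.
[cite: Lai2024BallRivoal, §4 Lemma 4.3] -/
theorem shard123 :
    Shard.check 128 (2^40)
      ⟨true, 80, 16, 437, 5, 132, 195345825254589, 195606207483697⟩ = true := by
  decide +kernel

set_option maxHeartbeats 100000000 in
/-- Shard 124: 80 cells of regime B from `5/132` to `9/230`.
[cite: Lai2024BallRivoal, §4 Lemma 4.3] -/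
theorem shard124 :
    Shard.check 128 (2^40)
      ⟨true, 80, 5, 132, 9, 230, 183558161261892, 183799572878157⟩ = true := by
  decide +kernel

set_option maxHeartbeats 100000000 in
/-- Shard 125: 80 cells of regime B from `9/230` to `13/322`.
[cite: Lai2024BallRivoal, §4 Lemma 4.3] -/
theorem shard125 :
    Shard.check 128 (2^40)
      ⟨true, 80, 9, 230, 13, 322, 178186056344019, 178432857840849⟩ = true := by
  decide +kernel

/-- The checked shards of this file, in order. [folklore] -/
def shards017 : List (CheckedShard 128 (2^40)) :=
  [⟨_, shard119⟩, ⟨_, shard120⟩, ⟨_, shard121⟩, ⟨_, shard122⟩, ⟨_, shard123⟩,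
    ⟨_, shard124⟩, ⟨_, shard125⟩]

end Summit.KontsevichZagierPeriods.Zeta5Search.Sweep
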